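import Literature.AlgebraicGeometry.HodgeTheory.FermatSurfaceHodgeCharacterTwiceCoprimeSix
import Literature.AlgebraicGeometry.Shioda1982.StandardQuadrupleLetter
import Literature.AlgebraicGeometry.Shioda1982.ExceptionalQuadruplesSweepSeventyFive
import HarnessLib

/-!
# Theorem C at the levels `m = 2m'`, `(m', 6) = 1`, `m' ∤ 35`: standard quadruples and the letter of `(𝔅²ₘ)` (ii)

Topic `Literature/AlgebraicGeometry/Shioda1982`. THEOREMS only (no definition, no named fact, no `sorry`).

`HodgeTheory/FermatSurfaceHodgeCharacterTwiceCoprimeSix` proves [Aoki1983, Thm. C] at the levels `m = 2m'` with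
`m'` prime to `6`, `m' ∤ 35` (a prime `≥ 11`, or the square of `5` or `7`, divides `m'`), in function form (`standard_of_isHodge_twice_coprime`: a primitive Hodge
character of length `4` is decomposable, of type A `(x, -2x, x + m', m')`, or of type B `(x, 2x + m', x + m', -4x)`).
This file rewrites that in the two other vocabularies of the tree:
* **`isStandardQuadruple_of_twice_coprime`**: the multiset of values of a pair-free primitive Hodge character of
  level `2m'` is a standard quadruple `t·L₁` or `t·L₂` of [MeyerNeutsch1981Fermatquadrupel, (13)–(14) p. 53]
  (`IsStandardQuadruple`, `ExceptionalQuadruples.lean`) — so there is no exceptional quadruple at these levels;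
* **`not_isExceptionalQuadruple_twice_coprime`**: `Δ(2m') = 0` — no Ausnahmequadrupel at these levels (the multiset form,
  the shape of the kernel sweeps `not_isExceptionalQuadruple_N`); with `forall_dvd_of_isPrimitive_even` (at even levels
  Meyer–Neutsch primitivity of the values of a Hodge character is `GCD(aᵢ) = 1`);
* **`exists_isExceptionalQuadruple_twice_coprimeSix_iff`**: for `(m', 6) = 1`, exceptional quadruples of level `2m'`
  exist iff `m' = 7` (the kernel sweeps settle `m ∈ {2, 10, 70}`, `level_fourteen` gives `(1, 7, 9, 11)`);
* **`thmB2m_standard_twice_coprime`**: the letter of the tree's named fact `AokiShioda1983_thmB2m_standard`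
  (`HodgeTheory/FermatSurfaceHodgeCharacterStructure`) at every level `m = 2m'`, `(m', 6) = 1`, `m' ∤ 35`:
  every indecomposable primitive Hodge character is a permutation of `αᵢ = (i, d+i, −2i, d)` or
  `βᵢ = (i, d+i, d+2i, −4i)`, `d = m'` (via `letter_of_isStandardQuadruple`, `StandardQuadrupleLetter.lean`).
The companion `PicardNumberTwicePrime.lean` is the case `m' = p ≥ 11` prime ([MeyerNeutsch1981Fermatquadrupel, Satz 2]);
the four levels `m' ∈ {1, 5, 7, 35}`, i.e. `m ∈ {2, 10, 14, 70}`, are not covered by it (no good prime): `m = 14`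
carries the exceptional orbit of `(1, 7, 9, 11)`, while at `m ∈ {2, 10, 70}` there is no exceptional quadruple (kernel
sweeps, `exists_isExceptionalQuadruple_twice_coprimeSix_iff` below; `Δ(10) = -2` is a coincidence of the `βᵢ`).

HONEST FRAMING (cell `pub-hfermat`): explicit algebraic cycles for specific Hodge classes on Fermat/Delsarte varieties;
residual open instances listed; no claim on general Hodge. (Surface classes are algebraic by Lefschetz (1,1); this file
restates a proved case of a structure theorem for `𝔅²ₘ`.)

## References
* [Aoki1983] N. Aoki, Math. Ann. 266 (1983) 23–54, Thm. C and §9.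
* [AokiShioda1983] N. Aoki, T. Shioda, Progr. Math. 35 (1983) 1–12, §2 Thm (𝔅²ₘ) (ii) a), b).
* [MeyerNeutsch1981Fermatquadrupel] W. Meyer, W. Neutsch, Math. Ann. 256 (1981) 51–62, (13)–(14) p. 53.
-/

namespace Literature.AlgebraicGeometry.Shioda1982

open Finset Multiset Literature.AlgebraicGeometry.HodgeTheory Literature.AlgebraicGeometry.HodgeTheory.FermatCharacter

section TwiceCoprime

variable {n : ℕ} [NeZero n]

omit [NeZero n] in
/-- The multiset of values of a `4`-tuple, listed along four pairwise distinct indices. [folklore] -/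
private theorem univ_val_map_eq_of_distinct {X : Type*} (α : Fin 4 → X) (a b c d : Fin 4) (hab : a ≠ b)
    (hac : a ≠ c) (had : a ≠ d) (hbc : b ≠ c) (hbd : b ≠ d) (hcd : c ≠ d) :
    univ.val.map α = {α a, α b, α c, α d} := by
  classical
  have hc4 : #({a, b, c, d} : Finset (Fin 4)) = 4 := by
    rw [Finset.card_insert_of_notMem (by simp [hab, hac, had]),
      Finset.card_insert_of_notMem (by simp [hbc, hbd]), Finset.card_pair hcd]
  have huniv : (univ : Finset (Fin 4)) = {a, b, c, d} :=
    (Finset.eq_univ_of_card _ (by rw [hc4]; simp)).symm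
  rw [huniv, Finset.insert_val, Multiset.ndinsert_of_notMem (by simp [hab, hac, had]), Finset.insert_val,
    Multiset.ndinsert_of_notMem (by simp [hbc, hbd]), Finset.insert_val,
    Multiset.ndinsert_of_notMem (by simp [hcd]), Finset.singleton_val]
  simp only [Multiset.insert_eq_cons, Multiset.map_cons, Multiset.map_singleton]

/-- **No exceptional quadruple at the levels `2m'`, `(m', 6) = 1`, `m' ∤ 35`:** the multiset of values of a
pair-free primitive Hodge character of length `4` and level `2m'` is a standard quadruple — a unit multiple of
`L₁ = (1, K, K+1, 2K−2)` (type A, `t = x`) or of `L₂ = (1, K+1, K+2, 2K−4)` (type B), `K = m'`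
(`standard_of_isHodge_twice_coprime`; `x·K = K` for the odd unit `x`).
[cite: Aoki1983, Thm. C] [cite: MeyerNeutsch1981Fermatquadrupel, (13)–(14) p. 53 (Standardquadrupel)] -/
theorem isStandardQuadruple_of_twice_coprime (h6 : n.Coprime 6) (hn35 : ¬ n ∣ 35)
    {α : Fin 4 → ZMod (2 * n)} (hα : IsHodge α)
    (hind : ∀ i j : Fin 4, i ≠ j → α i + α j ≠ 0) (hprim : ∀ g : ℕ, (∀ i, g ∣ (α i).val) → g = 1) :
    haveI : NeZero (2 * n) := ⟨mul_ne_zero two_ne_zero (NeZero.ne n)⟩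
    IsStandardQuadruple (2 * n) (univ.val.map α) := by
  classical
  haveI : NeZero (2 * n) := ⟨mul_ne_zero two_ne_zero (NeZero.ne n)⟩
  have h2 : 2 ∣ 2 * n := dvd_mul_right 2 n
  have hK : 2 * n / 2 = n := Nat.mul_div_cancel_left n two_pos
  have h2n : (2 : ZMod (2 * n)) * (n : ZMod (2 * n)) = 0 := by
    rw [show (2 : ZMod (2 * n)) = ((2 : ℕ) : ZMod (2 * n)) by norm_cast, ← Nat.cast_mul,
      ZMod.natCast_self]
  rcases standard_of_isHodge_twice_coprime h6 hn35 hα hprim with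
    ⟨i, j, hij, h⟩ | ⟨i₀, j₁, j₂, j₃, h01, h02, h03, h12, h13, h23, hu, e1, e2, e3⟩ |
    ⟨i₀, j₁, j₂, j₃, h01, h02, h03, h12, h13, h23, hu, e1, e2, e3⟩
  · exact absurd h (hind i j hij)
  · -- type A: `{x, -2x, x + n, n} = x · L₁`
    have hxn : (α i₀) * (n : ZMod (2 * n)) = n := by
      have := half_mul_unit h2 hu.unit
      rw [hK, IsUnit.unit_spec] at this
      rw [mul_comm (α i₀)]
      exact this
    refine ⟨hu.unit, Or.inl ⟨h2, Or.inl ?_⟩⟩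
    rw [univ_val_map_eq_of_distinct α i₀ j₁ j₂ j₃ h01 h02 h03 h12 h13 h23, e1, e2, e3, stdOne, hK]
    simp only [Multiset.insert_eq_cons, Multiset.map_cons, Multiset.map_singleton, IsUnit.unit_spec, mul_one]
    rw [show α i₀ * ((n : ZMod (2 * n)) + 1) = α i₀ + n by rw [mul_add, hxn, mul_one, add_comm],
      show α i₀ * (2 * (n : ZMod (2 * n)) - 2) = -2 * α i₀ by linear_combination (α i₀) * h2n, hxn]
    simp only [← Multiset.singleton_add]
    abel
  · -- type B: `{x, 2x + n, x + n, -4x} = x · L₂`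
    have hxn : (α i₀) * (n : ZMod (2 * n)) = n := by
      have := half_mul_unit h2 hu.unit
      rw [hK, IsUnit.unit_spec] at this
      rw [mul_comm (α i₀)]
      exact this
    refine ⟨hu.unit, Or.inl ⟨h2, Or.inr ?_⟩⟩
    rw [univ_val_map_eq_of_distinct α i₀ j₁ j₂ j₃ h01 h02 h03 h12 h13 h23, e1, e2, e3, stdTwo, hK]
    simp only [Multiset.insert_eq_cons, Multiset.map_cons, Multiset.map_singleton, IsUnit.unit_spec, mul_one]
    rw [show α i₀ * ((n : ZMod (2 * n)) + 1) = α i₀ + n by rw [mul_add, hxn, mul_one, add_comm],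
      show α i₀ * ((n : ZMod (2 * n)) + 2) = 2 * α i₀ + n by rw [mul_add, hxn]; ring,
      show α i₀ * (2 * (n : ZMod (2 * n)) - 4) = -4 * α i₀ by linear_combination (α i₀) * h2n]
    simp only [← Multiset.singleton_add]
    abel

/-! ### The multiset form: no exceptional quadruple at the levels `2m'`, `(m', 6) = 1`, `m' ∤ 35` -/

omit [NeZero n] in
/-- Divisibility of Meyer–Neutsch's `gcd(a₁, …, a_k, m)` (a right fold of `Nat.gcd`). [folklore] -/
private theorem dvd_foldr_gcd {d b : ℕ} {l : Multiset ℕ} (hb : d ∣ b) (hl : ∀ v ∈ l, d ∣ v) :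
    d ∣ l.foldr Nat.gcd b := by
  induction l using Multiset.induction_on with
  | empty => simpa using hb
  | cons a l ih =>
    rw [Multiset.foldr_cons]
    exact Nat.dvd_gcd (hl a (Multiset.mem_cons_self a l)) (ih fun v hv ↦ hl v (Multiset.mem_cons_of_mem hv))

omit [NeZero n] in
/-- A `4`-tuple whose multiset of values has no pair `a, -a` (as two members) is indecomposable. [folklore] -/
private theorem indecomposable_of_not_hasPair {m : ℕ} {α : Fin 4 → ZMod m} (h : ¬ HasPair (univ.val.map α)) :
    ∀ i j : Fin 4, i ≠ j → α i + α j ≠ 0 := by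
  classical
  intro i j hij hsum
  apply h
  refine ⟨α i, Multiset.mem_map.mpr ⟨i, Finset.mem_univ_val i, rfl⟩, ?_⟩
  have hneg : -α i = α j := by linear_combination (-1 : ZMod m) * hsum
  rw [hneg]
  by_cases he : α j = α i
  · have h2 : 2 ≤ Multiset.count (α i) (univ.val.map α) := by
      rw [count_univ_val_map]
      exact Finset.one_lt_card.mpr ⟨i, by simp, j, by simp [he], hij⟩
    rw [he, ← Multiset.count_pos, Multiset.count_erase_self]
    omega
  · exact (Multiset.mem_erase_of_ne he).mpr (Multiset.mem_map.mpr ⟨j, Finset.mem_univ_val j, rfl⟩)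

/-- At an EVEN level, Meyer–Neutsch primitivity `gcd(a₁, …, a₄, m) = 1` of the multiset of values of a Hodge
character gives `GCD(aᵢ) = 1` in the letter of the named fact (a common divisor `g` of the `aᵢ` divides
`∑ aᵢ = 2m` and is prime to `m`, so `g ∣ 2`, and `g = 2` is not prime to the even `m`).
[cite: MeyerNeutsch1981Fermatquadrupel, (9)–(10) p. 52] -/
theorem forall_dvd_of_isPrimitive_even {α : Fin 4 → ZMod (2 * n)} (hα : IsHodge α)
    (hp : IsPrimitive (2 * n) (univ.val.map α)) : ∀ g : ℕ, (∀ i, g ∣ (α i).val) → g = 1 := by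
  intro g hg
  have hn0 : n ≠ 0 := NeZero.ne n
  -- `∑ ⟨aᵢ⟩ = 2m`
  have hsum : ∑ i, (α i).val = 2 * (2 * n) := by
    have h1 := hα.2 1
    simp only [Units.val_one, one_mul] at h1
    change 2 * ∑ i, (α i).val = 2 * n * 4 at h1
    omega
  have hg4 : g ∣ 2 * (2 * n) := hsum ▸ Finset.dvd_sum fun i _ ↦ hg i
  -- `gcd(g, m) = 1`
  have hcop : Nat.Coprime g (2 * n) := by
    have hd : Nat.gcd g (2 * n) ∣ ((univ.val.map α).map ZMod.val).foldr Nat.gcd (2 * n) := by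
      refine dvd_foldr_gcd (Nat.gcd_dvd_right _ _) fun v hv ↦ ?_
      obtain ⟨a, ha, rfl⟩ := Multiset.mem_map.mp hv
      obtain ⟨i, -, rfl⟩ := Multiset.mem_map.mp ha
      exact (Nat.gcd_dvd_left _ _).trans (hg i)
    unfold IsPrimitive at hp
    rw [hp] at hd
    exact Nat.dvd_one.mp hd
  have hg2 : g ∣ 2 := hcop.dvd_of_dvd_mul_right hg4
  have hg0 : g ≠ 0 := fun h ↦ by rw [h] at hg2; exact absurd (Nat.eq_zero_of_zero_dvd hg2) two_ne_zero
  have hgle : g ≤ 2 := Nat.le_of_dvd two_pos hg2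
  interval_cases g
  · exact absurd rfl hg0
  · rfl
  · exfalso
    have h2 : Nat.gcd 2 (2 * n) = 2 := Nat.gcd_eq_left (dvd_mul_right 2 n)
    have h1 := Nat.Coprime.gcd_eq_one hcop
    rw [h2] at h1
    exact absurd h1 (by norm_num)

/-- **`Δ(2m') = 0` for `(m', 6) = 1`, `m' ∉ {1, 5, 7, 35}`: there is NO exceptional quadruple (Ausnahmequadrupel) at these
levels** — every Hodge `4`-multiset without a pair `a, -a` and with `gcd(a₁, …, a₄, m) = 1` is a unit multiple of `L₁` or `L₂`
([Aoki1983, Thm. C] at these levels, in the vocabulary of [MeyerNeutsch1981Fermatquadrupel] / [Shioda1982PicardFermat, Prop. 4];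
the kernel sweeps `not_isExceptionalQuadruple_N` are the levels `N ≤ 180` and a few others, `PicardNumberTwicePrime` is `m' = p`).
[cite: Aoki1983, Thm. C] [cite: MeyerNeutsch1981Fermatquadrupel, p. 53 (Standard- und Ausnahmequadrupel)] -/
theorem not_isExceptionalQuadruple_twice_coprime (h6 : n.Coprime 6) (hn35 : ¬ n ∣ 35) (s : Multiset (ZMod (2 * n))) :
    haveI : NeZero (2 * n) := ⟨mul_ne_zero two_ne_zero (NeZero.ne n)⟩
    ¬ IsExceptionalQuadruple (2 * n) s := by
  haveI : NeZero (2 * n) := ⟨mul_ne_zero two_ne_zero (NeZero.ne n)⟩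
  rintro ⟨h4, hs, hnp, hprim, hns⟩
  obtain ⟨r, α, rfl⟩ := exists_eq_univ_val_map s
  have hr : r = 4 := by rw [card_univ_val_map] at h4; exact h4
  subst hr
  have hα : IsHodge α := (isHodge_iff_isHodgeMultiset α).2 hs
  exact hns (isStandardQuadruple_of_twice_coprime h6 hn35 hα (indecomposable_of_not_hasPair hnp)
    (forall_dvd_of_isPrimitive_even hα hprim))

/-- **At the levels `m = 2m'`, `(m', 6) = 1`, exceptional quadruples exist iff `m' = 7`** (`m = 14`: Meyer–Neutsch's
`(1, 7, 9, 11)`, `ExceptionalQuadruples.level_fourteen`): `not_isExceptionalQuadruple_twice_coprime` off `m' ∣ 35`, and the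
kernel sweeps at the levels `2, 10, 70` (`tabelleOne N = []`, `not_isExceptionalQuadruple_of_le_seventyFive`).
[cite: Aoki1983, Thm. C] [cite: MeyerNeutsch1981Fermatquadrupel, Satz 2 p. 56 and Tabelle 1 p. 54] [cite: Shioda1982PicardFermat, table p. 727] -/
theorem exists_isExceptionalQuadruple_twice_coprimeSix_iff (h6 : n.Coprime 6) :
    haveI : NeZero (2 * n) := ⟨mul_ne_zero two_ne_zero (NeZero.ne n)⟩
    (∃ s, IsExceptionalQuadruple (2 * n) s) ↔ n = 7 := by
  haveI : NeZero (2 * n) := ⟨mul_ne_zero two_ne_zero (NeZero.ne n)⟩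
  constructor
  · rintro ⟨s, hs⟩
    by_contra h7
    by_cases hn35 : n ∣ 35
    · have hdiv : n = 1 ∨ n = 5 ∨ n = 7 ∨ n = 35 := by
        have h := Nat.mem_divisors.mpr ⟨hn35, (by norm_num : (35 : ℕ) ≠ 0)⟩
        rw [show Nat.divisors 35 = {1, 5, 7, 35} from by decide] at h
        simpa using h
      rcases hdiv with rfl | rfl | rfl | rfl
      · exact not_isExceptionalQuadruple_of_le_seventyFive (2 * 1) (by norm_num) (by norm_num) (by decide) s hs
      · exact not_isExceptionalQuadruple_of_le_seventyFive (2 * 5) (by norm_num) (by norm_num) (by decide) s hs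
      · exact h7 rfl
      · exact not_isExceptionalQuadruple_of_le_seventyFive (2 * 35) (by norm_num) (by norm_num) (by decide) s hs
    · exact not_isExceptionalQuadruple_twice_coprime h6 hn35 s hs
  · rintro rfl
    obtain ⟨s, hs⟩ := List.exists_mem_of_length_pos (l := reps 14) (by decide)
    exact ⟨s, level_fourteen.1 s hs⟩

/-- **Aoki–Shioda 1983, Theorem `(𝔅²ₘ)` (ii) at the levels `m = 2m'`, `(m', 6) = 1`, `m' ∤ 35`, in the letter of the
tree's named fact `Literature.AlgebraicGeometry.HodgeTheory.AokiShioda1983_thmB2m_standard`:** every indecomposable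
primitive Hodge character `α` of length `4` and level `m` is, after a permutation of the coordinates,
a) `(i, d + i, −2i, d)` or b) `(i, d + i, d + 2i, −4i)` with `m = 2d`, `1 ≤ i < d`, `(i, d) = 1` (and `3i, 4i, 6i ≠ m`);
alternative c) (`m = 3d`) does not occur. This is the body of that fact at these `m` (for all such `m`, not only `m > 180`):
[Aoki1983, Thm. C] there (`isStandardQuadruple_of_twice_coprime`) and the generic bridge `letter_of_isStandardQuadruple`.
[cite: AokiShioda1983, §2 Theorem (𝔅²ₘ) (ii) a), b), p. 3] [cite: Aoki1983, Thm. C] -/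
theorem thmB2m_standard_twice_coprime (m : ℕ) [NeZero m] (hm : m = 2 * n) (h6 : n.Coprime 6)
    (hn35 : ¬ n ∣ 35) (α : Fin 4 → ZMod m) (hα : IsHodge α)
    (hind : ∀ i j : Fin 4, i ≠ j → α i + α j ≠ 0) (hprim : ∀ g : ℕ, (∀ i, g ∣ (α i).val) → g = 1) :
    ∃ σ : Equiv.Perm (Fin 4),
      (∃ d i : ℕ, m = 2 * d ∧ 1 ≤ i ∧ i < d ∧ Nat.Coprime i d ∧ 4 * i ≠ m ∧
          ∀ k, α (σ k) = ![(i : ZMod m), (d : ZMod m) + i, -(2 * (i : ZMod m)), (d : ZMod m)] k) ∨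
      (∃ d i : ℕ, m = 2 * d ∧ 1 ≤ i ∧ i < d ∧ Nat.Coprime i d ∧ 3 * i ≠ m ∧ 4 * i ≠ m ∧ 6 * i ≠ m ∧
          ∀ k, α (σ k) = ![(i : ZMod m), (d : ZMod m) + i, (d : ZMod m) + 2 * i, -(4 * (i : ZMod m))] k) ∨
      (∃ d j : ℕ, m = 3 * d ∧ 1 ≤ j ∧ j < d ∧ Nat.Coprime j d ∧ 6 * j ≠ m ∧
          ∀ k, α (σ k) = ![(j : ZMod m), (d : ZMod m) + j, 2 * (d : ZMod m) + j, -(3 * (j : ZMod m))] k) := by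
  subst hm
  exact letter_of_isStandardQuadruple hα.1.1 hind
    (isStandardQuadruple_of_twice_coprime h6 hn35 hα hind hprim)

end TwiceCoprime

end Literature.AlgebraicGeometry.Shioda1982
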